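import Summits.NavierStokesRegularity.NavierStokesRegularity.Theorems.SoloRefuteNadirashvili2026SN1

/-!
# C129 `Nadirashvili2026` — records-grade erratum: display (5.20) p.37 l.1–3 AS PRINTED is false
# at the carrier (Galerkin) grain [Nadirashvili2026]

UNREFEREED / DISPUTED CLAIM — cell `ns-claims` (D-0090), claim C129, ADJUDICATED #116 (locator
`Literature.Claims.NS.Nadirashvili2026.Step_subsol` = (5.18) p.36, class false lemma (countermodel);
this file changes neither). The skeleton records the printed direction of (5.20) («Φ′(δ,t) > 0»,
i.e. `E_r(δ,t) < y′_k(δ)` for every Galerkin field whose level `∂⁵E/∂r⁵(0)` exceeds `k`) as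
`Step_520_printed`, noting that (5.19) gives the OPPOSITE sign and that the argument at p.37 l.18–19
needs `Φ_r(δ,t) < 0` (what `Step_sup` takes, kernel-TRUE p499670). Here: the printed direction is
false, by the circularly polarised single Fourier mode of `SoloRefuteNadirashvili2026SN1.lean`
(p501149) taken one frequency HIGHER than the carrier witness — `n = M⁸ + 1` at `k = M¹⁶`, so
that the level `d5 a = (M⁸+1)²` lies STRICTLY INSIDE the paper's own level window `(k, 2k]` of
Step 5 p.36 — for which, at `δ = k^{-3/2} = M⁻²⁴`,
`E′(δ) ≥ (M⁸+1)²δ⁴/24 − (π²/25)(1+M⁻⁸)⁴M⁻¹¹² ≥ M⁻⁸⁰/24 + (41/8)M⁻⁹⁹ = y′_k(δ)`.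
Author ns-claims-refuter-5 g2 (refuter of record for C129).

WHAT THIS IS NOT: not a claim about NS regularity or blow-up; not a claim about any author beyond
the typed locator.
-/

set_option linter.dupNamespace false

noncomputable section

open MeasureTheory Set Metric
open scoped InnerProductSpace RealInnerProductSpace

namespace Summit.NavierStokesRegularity.NavierStokesRegularity.Theorems.Nadirashvili2026

open Literature.Claims.NS.Nadirashvili2026
open Literature.Analysis.FunctionSpaces Literature.Analysis.FluidPDE


/-- `s + s³/6 − s⁵/100 ≤ sinh s` on `[0, 1]` (Taylor, `Real.exp_bound` with `n = 5`). [folklore] -/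
theorem taylor_le_sinh {s : ℝ} (h0 : 0 ≤ s) (h1 : s ≤ 1) :
    s + s ^ 3 / 6 - s ^ 5 / 100 ≤ Real.sinh s := by
  have hs : |s| ≤ 1 := abs_le.2 ⟨by linarith, h1⟩
  have hs' : |(-s)| ≤ 1 := by rwa [abs_neg]
  have h₁ := Real.exp_bound hs (n := 5) (by norm_num)
  have h₂ := Real.exp_bound hs' (n := 5) (by norm_num)
  simp only [Finset.sum_range_succ, Finset.sum_range_zero, Nat.factorial] at h₁ h₂
  rw [abs_of_nonneg h0] at h₁
  rw [abs_neg, abs_of_nonneg h0] at h₂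
  norm_num at h₁ h₂
  have e1 := (abs_le.1 h₁).1
  have e2 := (abs_le.1 h₂).2
  rw [Real.sinh_eq]
  nlinarith [e1, e2]

/-- The (5.20)-as-printed core: at `k = M¹⁶`, `δ = M^{-24}`, for the mode `n = M⁸ + 1`
(`d5 = (M⁸+1)²`), `y′_k(δ) = M^{-80}/24 + (41/8)M^{-99} ≤ E′(δ)`
(`E′(δ) ≥ (M⁸+1)² δ⁴/24 − (π²/25)(1 + M^{-8})⁴ M^{-112}`). [folklore] -/
theorem sn1_core_520 {M : ℝ} (hM : 2 ≤ M) :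
    M ^ 16 / 24 * (M⁻¹ ^ 24) ^ 4 + 41 / 8 * M⁻¹ ^ 99 ≤
      sn1Amp ^ 2 * (2 * Real.pi * M⁻¹ ^ 24 *
        (Real.sinh (2 * (2 * Real.pi * (M ^ 8 + 1)) * M⁻¹ ^ 24) /
            (2 * (2 * Real.pi * (M ^ 8 + 1))) - M⁻¹ ^ 24)) := by
  have hM0 : 0 < M := by linarith
  have hπ := Real.pi_pos
  have hπ0 : Real.pi ≠ 0 := hπ.ne'
  set t : ℝ := M⁻¹ with ht
  have ht0 : 0 < t := inv_pos.2 hM0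
  have ht0' : t ≠ 0 := ht0.ne'
  have ht1 : t ≤ 1 / 2 := by rw [ht, one_div]; exact inv_anti₀ (by norm_num) hM
  have htle1 : t ≤ 1 := ht1.trans (by norm_num)
  have hMt : M * t = 1 := mul_inv_cancel₀ hM0.ne'
  have hM' : M = t⁻¹ := by rw [ht, inv_inv]
  have h1t8 : 0 < 1 + t ^ 8 := by positivity
  have harg : 2 * (2 * Real.pi * (M ^ 8 + 1)) * t ^ 24 = 4 * Real.pi * (t ^ 16 * (1 + t ^ 8)) := by
    have h8 : M ^ 8 * t ^ 24 = t ^ 16 := by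
      have : M ^ 8 * t ^ 24 = (M * t) ^ 8 * t ^ 16 := by ring
      rw [this, hMt, one_pow, one_mul]
    linear_combination (4 * Real.pi) * h8
  rw [harg]
  set s : ℝ := 4 * Real.pi * (t ^ 16 * (1 + t ^ 8)) with hs
  have ht8 : t ^ 8 ≤ (1 / 2) ^ 8 := by gcongr
  have ht16 : t ^ 16 ≤ (1 / 2) ^ 16 := by gcongr
  have hs0 : 0 ≤ s := by positivity
  have hs1 : s ≤ 1 := by
    rw [hs]
    have : t ^ 16 * (1 + t ^ 8) ≤ (1 / 2) ^ 16 * (1 + (1 / 2) ^ 8) := by gcongr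
    nlinarith [Real.pi_lt_four, this]
  have hsinh := taylor_le_sinh hs0 hs1
  rw [hM', sn1Amp_sq]
  have hL : t⁻¹ ^ 16 / 24 * (t ^ 24) ^ 4 + 41 / 8 * t ^ 99 =
      t ^ 80 / 24 + 41 / 8 * t ^ 99 := by
    field_simp
  have hR : (128 * Real.pi ^ 3)⁻¹ * (2 * Real.pi * t ^ 24 *
      (Real.sinh s / (2 * (2 * Real.pi * (t⁻¹ ^ 8 + 1))) - t ^ 24)) =
      t ^ 32 * Real.sinh s / (256 * Real.pi ^ 3 * (1 + t ^ 8)) - t ^ 48 / (64 * Real.pi ^ 2) := by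
    field_simp
    ring
  rw [hL, hR]
  have h1 : t ^ 32 * (s + s ^ 3 / 6 - s ^ 5 / 100) / (256 * Real.pi ^ 3 * (1 + t ^ 8)) ≤
      t ^ 32 * Real.sinh s / (256 * Real.pi ^ 3 * (1 + t ^ 8)) := by
    gcongr
  have h2 : t ^ 32 * (s + s ^ 3 / 6 - s ^ 5 / 100) / (256 * Real.pi ^ 3 * (1 + t ^ 8)) -
      t ^ 48 / (64 * Real.pi ^ 2) =
      t ^ 80 * (1 + t ^ 8) ^ 2 / 24 - Real.pi ^ 2 / 25 * (t ^ 112 * (1 + t ^ 8) ^ 4) := by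
    rw [hs]; field_simp; ring
  have h3 : (1 + t ^ 8) ^ 4 ≤ 2 := by
    have : (1 + t ^ 8) ^ 4 ≤ (1 + (1 / 2) ^ 8) ^ 4 := by gcongr
    exact this.trans (by norm_num)
  have h4 : Real.pi ^ 2 / 25 * (t ^ 112 * (1 + t ^ 8) ^ 4) ≤ 16 / 25 * (t ^ 112 * 2) := by
    have hπ2 : Real.pi ^ 2 / 25 ≤ 16 / 25 := by nlinarith [Real.pi_lt_four, hπ]
    exact mul_le_mul hπ2 (mul_le_mul_of_nonneg_left h3 (by positivity)) (by positivity)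
      (by positivity)
  have h99 : t ^ 99 ≤ t ^ 88 * (1 / 2) ^ 11 := by
    calc t ^ 99 = t ^ 88 * t ^ 11 := by ring
      _ ≤ t ^ 88 * (1 / 2) ^ 11 := by gcongr
  have h112 : t ^ 112 ≤ t ^ 88 * (1 / 2) ^ 24 := by
    calc t ^ 112 = t ^ 88 * t ^ 24 := by ring
      _ ≤ t ^ 88 * (1 / 2) ^ 24 := by gcongr
  have e1 : t ^ 80 * (1 + t ^ 8) ^ 2 / 24 = t ^ 80 / 24 + t ^ 88 / 12 + t ^ 96 / 24 := by ring
  have h96 : (0 : ℝ) ≤ t ^ 96 := by positivity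
  have h88 : (0 : ℝ) ≤ t ^ 88 := by positivity
  nlinarith [h1, h2, h4, h99, h112, e1, h96, h88]

/-- **(5.20) p.37 l.1–3 AS PRINTED is false at the carrier grain** («Φ′(δ,t) > 0», i.e.
`E_r(δ,t) < y′_k(δ)` whenever `∂⁵E/∂r⁵(0) > k`): for `B = 1` and every `k₀`, `M = max(2,⌈k₀⌉)`,
`k = M¹⁶`, the circularly polarised mode with `n = M⁸ + 1` — level `d5 a = (M⁸+1)² ∈ (k, 2k)`,
INSIDE the level window `(k, 2k]` of the paper's own Step 5 (p.36), energy `A²/2 ≤ 1` — has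
`E′(δ) ≥ (M⁸+1)²δ⁴/24 − (π²/25)(1+M^{-8})⁴M^{-112} ≥ y′_k(δ)` at `δ = k^{-3/2} = M^{-24}`
(`sn1_core_520`). Records-grade erratum only: the print's (5.20) is the sign slip of (5.19) that
the referee reads as intended inside `Step_sup` (TRUE, p499670); locator / class / totals of #116
untouched. [cite: Nadirashvili2026, §5 (5.20) p.37; HYGIENE 13] -/
theorem not_Step_520_printed : ¬ Literature.Claims.NS.Nadirashvili2026.Step_520_printed := by
  intro h
  obtain ⟨k₀, hk₀⟩ := h 1 zero_le_one
  obtain ⟨M, hM2, hMk⟩ : ∃ M : ℕ, 2 ≤ M ∧ k₀ ≤ (M : ℝ) :=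
    ⟨max 2 ⌈k₀⌉₊, le_max_left _ _,
      (Nat.le_ceil k₀).trans (by exact_mod_cast le_max_right 2 ⌈k₀⌉₊)⟩
  have hM0 : (0 : ℝ) < M := by exact_mod_cast (show 0 < M by omega)
  have hM1 : (1 : ℝ) ≤ M := by exact_mod_cast (show 1 ≤ M by omega)
  have hM2' : (2 : ℝ) ≤ M := by exact_mod_cast hM2
  have hn0 : M ^ 8 + 1 ≠ 0 := Nat.succ_ne_zero _
  have hk : k₀ ≤ (M : ℝ) ^ 16 := hMk.trans (le_self_pow₀ hM1 (by norm_num))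
  have hd5 : (M : ℝ) ^ 16 < d5 (sn1Mode (M ^ 8 + 1)) := by
    rw [d5_sn1Mode hn0]; push_cast
    have : (0 : ℝ) < (M : ℝ) ^ 8 := by positivity
    nlinarith
  have key := hk₀ _ hk (M ^ 8 + 1) (sn1Mode (M ^ 8 + 1)) (isGalerkinMode_sn1Mode _)
    (kineticEnergy_sn1Mode_le _) hd5
  have hδ0 : (0 : ℝ) < (M : ℝ)⁻¹ ^ 24 := by positivity
  rw [sn1g_rpow_neg_three_halves hM0, deriv_cE_sn1Mode hn0 hδ0, dyk,
    sn1g_rpow_33_8 (inv_pos.2 hM0).le, Nat.cast_add, Nat.cast_pow, Nat.cast_one] at key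
  exact absurd key (not_lt.2 (sn1_core_520 hM2'))

end Summit.NavierStokesRegularity.NavierStokesRegularity.Theorems.Nadirashvili2026

end
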